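import Mathlib.Data.List.GetD
import Literature.MathematicalPhysics.StatisticalMechanics.LennardJonesClusters

/-!
# Route `ReggeStarCoercivity`, crux `StabilityConstantTwelve` (stmt-AtomisticToContinuum-13601) —
# negative side I: pair counting, the injectivity witness, and the certified evaluation machine

Supporting file for the CLOSED item stmt-AtomisticToContinuum-13601 (`stabilityConstantTwelve_proof`,
`E(N) ≥ -N` for `N` distinct Lennard-Jones particles in `ℝ³`, `B_LJ ≤ 12 ε`).  Port into `Theorems/`
(LEAN-IN-TREE rule, 2026-08-18: the kernel-checked claims of the publication bundle
`papers/AtomisticToContinuum/blj-12eps` must be Theorems-grade tree declarations) of §§1–3 of the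
disprover's crux workfile `Summits/AtomisticToContinuum/Crystallization/Cruxes/StabilityConstantTwelve/Disproof.lean`
(namespace `Summit.AtomisticToContinuum.Crystallization.Cruxes.StabilityConstantTwelve.Disproof`,
2026-08-16; same declaration names; statements and proofs verbatim — the bundle's hand package
carried the same text as `LJStability/Negative.lean:86–372`):

* §1 `interactionEnergy_ge_pairs`, `pair_lower_bound`, `stabilityConstantTwelve_upTo25` — pair
  counting gives `E(N) ≥ -N(N-1)/24 ≥ -N` for `N ≤ 25` (the first case with content is `N = 26`);
* §2 `stabilityConstantTwelve_false_without_injective` — with coincident points allowed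
  (`V_LJ(0) = 0` by `0⁻¹ = 0`) the statement fails at `N = 49` (24 + 25 points piled at distance 1):
  ANY PROOF MUST USE INJECTIVITY;
* §3 the certified evaluation machine `Cert.*`: a configuration given by natural-number rows `L`
  at scale `√s` has `2·𝓔 = hsum L s ∈ ℚ` exactly (`two_mul_interactionEnergy_config`,
  `hsum_eq_dsum`), whence `groundStateEnergy_le_of_cert : hsum L s ≤ 2b → E(|L|) ≤ b` and the
  site-energy / separation readers `siteEnergy_config`, `sep_config`; every concrete certificate
  (`…NegWitnesses.lean`, `…NegDFour.lean`) is then ONE `decide +kernel` on `ℚ` (no `native_decide`,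
  standard axioms).
-/

noncomputable section

namespace Summit.AtomisticToContinuum.Crystallization.Theorems.StabilityConstantTwelveNegative

open Literature.MathematicalPhysics.StatisticalMechanics

variable {d N : ℕ}

/-! ## §1 The trivial range `N ≤ 25` (pair counting) -/

/-- Pair counting: every configuration of `N` points (injective or not, any dimension) has
`𝓔_N ≥ -N(N-1)/24`, since each of the `N(N-1)/2` pairs contributes `≥ min V_LJ = -1/12`.
[port of `…Cruxes.StabilityConstantTwelve.Disproof.interactionEnergy_ge_pairs`] -/
theorem interactionEnergy_ge_pairs {d N : ℕ} (x : Fin N → EuclideanSpace ℝ (Fin d)) :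
    -((N : ℝ) * (N - 1) / 24) ≤ interactionEnergy lennardJones x := by
  have h2 := two_mul_interactionEnergy lennardJones x
  have hsite : ∀ i, -((N - 1 : ℝ) / 12) ≤ siteEnergy lennardJones x i := fun i => by
    unfold siteEnergy
    have hN : 1 ≤ N := i.pos
    have hc : ((Finset.univ.erase i).card : ℝ) = N - 1 := by
      rw [Finset.card_erase_of_mem (Finset.mem_univ i), Finset.card_univ, Fintype.card_fin,
        Nat.cast_sub hN, Nat.cast_one]
    calc -((N - 1 : ℝ) / 12) = ∑ _k ∈ Finset.univ.erase i, (-1 / 12 : ℝ) := by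
          rw [Finset.sum_const, nsmul_eq_mul, hc]; ring
      _ ≤ _ := Finset.sum_le_sum fun k _ => neg_one_div_le_lennardJones _
  have := Finset.sum_le_sum fun i (_ : i ∈ Finset.univ) => hsite i
  rw [Finset.sum_const, Finset.card_univ, Fintype.card_fin, nsmul_eq_mul] at this
  linarith

/-- Hence `E(N) ≥ -N(N-1)/24` in `ℝ³`. [port of `…Cruxes.StabilityConstantTwelve.Disproof.pair_lower_bound`] -/
theorem pair_lower_bound (N : ℕ) :
    -((N : ℝ) * (N - 1) / 24) ≤ groundStateEnergy lennardJones 3 N := by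
  haveI := nonempty_injective_config (d := 3) (by norm_num) N
  exact le_ciInf fun x => interactionEnergy_ge_pairs x.1

/-- TRIVIAL RANGE: `E(N) ≥ -N` holds for `N ≤ 25` by pair counting alone (`N(N-1)/24 ≤ N` iff
`N ≤ 25`); the first case with content is `N = 26`. [port of `…Cruxes.StabilityConstantTwelve.Disproof.stabilityConstantTwelve_upTo25`] -/
theorem stabilityConstantTwelve_upTo25 {N : ℕ} (hN : N ≤ 25) :
    -(N : ℝ) ≤ groundStateEnergy lennardJones 3 N := by
  refine le_trans ?_ (pair_lower_bound N)
  have h25 : (N : ℝ) ≤ 25 := by exact_mod_cast hN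
  have h0 : (0 : ℝ) ≤ N := N.cast_nonneg
  nlinarith

/-! ## §2 Injectivity (distinct points) is load-bearing -/

/-- The statement with injectivity DROPPED: all configurations `x : Fin N → ℝ³`, coincidences
allowed (then `V_LJ(0) = 0` by `0⁻¹ = 0`). [port of `…Cruxes.StabilityConstantTwelve.Disproof.StabilityConstantTwelveWithoutInjective`] -/
def StabilityConstantTwelveWithoutInjective : Prop :=
  ∀ (N : ℕ) (x : Fin N → EuclideanSpace ℝ (Fin 3)), -(N : ℝ) ≤ interactionEnergy lennardJones x

/-- A constant configuration has zero Lennard-Jones energy (`V_LJ(0) = 0`).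
[port of `…Cruxes.StabilityConstantTwelve.Disproof.interactionEnergy_const`] -/
theorem interactionEnergy_const {d M : ℕ} (c : EuclideanSpace ℝ (Fin d)) :
    interactionEnergy lennardJones (fun _ : Fin M => c) = 0 := by
  simp [interactionEnergy, lennardJones_zero]

/-- ANY PROOF MUST USE INJECTIVITY: `24` particles at `0` and `25` at `e₀`, `|e₀| = 1`, have
energy `24 · 25 · V_LJ(1) = -50 < -49`. (Smallest such `N` is `49`: `⌊N/2⌋⌈N/2⌉/12 > N` iff
`N ≥ 49`.) [port of `…Cruxes.StabilityConstantTwelve.Disproof.stabilityConstantTwelve_false_without_injective`] -/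
theorem stabilityConstantTwelve_false_without_injective :
    ¬ StabilityConstantTwelveWithoutInjective := by
  intro h
  set e₀ : EuclideanSpace ℝ (Fin 3) := EuclideanSpace.single 0 1 with he₀
  have key := h (24 + 25) (Fin.append (fun _ : Fin 24 => (0 : EuclideanSpace ℝ (Fin 3)))
    (fun _ : Fin 25 => e₀))
  rw [interactionEnergy_append lennardJones lennardJones_zero, interactionEnergy_const,
    interactionEnergy_const] at key
  have hd : dist (0 : EuclideanSpace ℝ (Fin 3)) e₀ = 1 := by
    rw [dist_comm, dist_zero_right, he₀, PiLp.norm_single, norm_one]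
  simp only [hd, lennardJones_one, Finset.sum_const, Finset.card_univ, Fintype.card_fin,
    nsmul_eq_mul] at key
  norm_num at key

/-! ## §3 A certified evaluation machine (natural-number rows at scale `√s`) -/

namespace Cert

/-! Certified evaluation machine (natural-number rows, one-pass distance histogram):
a configuration is given by rows `L : List (List ℕ)` (coordinates, any common translate) and a
rational scale `s`; its points are `√s · L[i]`, and `2 E = hsum L s ∈ ℚ` exactly, decided by the
kernel (`decide +kernel`; `Nat` arithmetic is GMP-accelerated there, hence `ℕ` rows).
[port of `…Cruxes.StabilityConstantTwelve.Disproof.Cert.*`] -/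

/-- `(a - b)²` computed inside `ℕ` (no truncation: `2ab ≤ a² + b²`). -/
def sqDiffN (a b : ℕ) : ℕ := a * a + b * b - 2 * a * b

/-- squared distance of two rows. -/
def sqDistN : List ℕ → List ℕ → ℕ
  | a :: u, b :: v => sqDiffN a b + sqDistN u v
  | _, _ => 0

/-- `V_LJ` as a function of the SQUARED distance, over `ℚ` and over `ℝ`. -/
def Wq (q : ℚ) : ℚ := (1 / 12) * (q⁻¹) ^ 6 - (1 / 6) * (q⁻¹) ^ 3
/-- `V_LJ` as a function of the SQUARED distance, real version: `W(q) = q⁻⁶/12 - q⁻³/6`. -/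
def W (q : ℝ) : ℝ := (1 / 12) * (q⁻¹) ^ 6 - (1 / 6) * (q⁻¹) ^ 3

/-- twice the energy as the plain double sum (specification). -/
def dsum (L : List (List ℕ)) (s : ℚ) : ℚ :=
  (L.map fun u => (L.map fun v => Wq (s * sqDistN u v)).sum).sum

/-- histogram update (association list `squared distance ↦ count`). -/
def incr : List (ℕ × ℕ) → ℕ → List (ℕ × ℕ)
  | [], m => [(m, 1)]
  | (m', c) :: t, m => if m' = m then (m', c + 1) :: t else (m', c) :: incr t m

/-- histogram of the squared distances from the row `u` to all rows of `L` (one row at a time: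
this bounds the depth of unevaluated accumulators in the kernel by `|L|`). -/
def rowHist (L : List (List ℕ)) (u : List ℕ) : List (ℕ × ℕ) :=
  L.foldl (fun acc v => incr acc (sqDistN u v)) []

/-- twice the energy, evaluated row by row through histograms (what the kernel computes). -/
def hsum (L : List (List ℕ)) (s : ℚ) : ℚ :=
  (L.map fun u => ((rowHist L u).map fun p => (p.2 : ℚ) * Wq (s * p.1)).sum).sum

/-- all rows of length `d` with entries in `[0, 2r]`. -/
def boxVecs : ℕ → ℕ → List (List ℕ)
  | 0, _ => [[]]
  | d + 1, r => (boxVecs d r).flatMap fun v => (List.range (2 * r + 1)).map fun k => k :: v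

/-- squared norm of the centred row `v - (r,…,r)`. -/
def normSqC (r : ℕ) (v : List ℕ) : ℕ := (v.map fun a => sqDiffN a r).sum

/-- the `Dₙ`-type ball, translated by `(r,…,r)`: rows `v ∈ [0,2r]ᵈ` with `∑ (vᵢ - r)` even and
`|v - (r,…,r)|² ≤ R2` (`d = 3`: fcc balls; centre included). -/
def dBall (d r R2 : ℕ) : List (List ℕ) :=
  (boxVecs d r).filter fun v => decide ((v.sum + d * r) % 2 = 0 ∧ normSqC r v ≤ R2)

/-- the real configuration with coordinates `√s · L[i][k]`. -/
def config (d : ℕ) (s : ℚ) (L : List (List ℕ)) : Fin L.length → EuclideanSpace ℝ (Fin d) :=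
  fun i => WithLp.toLp 2 fun k : Fin d => Real.sqrt s * (((L.get i).getD (k : ℕ) 0 : ℕ) : ℝ)

/-- `sqDiffN a b` casts to `(a - b)²` in `ℝ`. -/
theorem cast_sqDiffN (a b : ℕ) : ((sqDiffN a b : ℕ) : ℝ) = ((a : ℝ) - b) ^ 2 := by
  unfold sqDiffN
  have h : 2 * a * b ≤ a * a + b * b := by nlinarith [sq_nonneg ((a : ℤ) - b)]
  rw [Nat.cast_sub h]
  push_cast
  ring

/-- `V_LJ(r) = W(r²)`. -/
theorem lennardJones_eq_W (r : ℝ) : lennardJones r = W (r ^ 2) := by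
  simp only [lennardJones, W, inv_pow, ← pow_mul]

/-- `W` agrees with the exact rational `Wq` on rational arguments. -/
theorem W_cast (q : ℚ) : W (q : ℝ) = (Wq q : ℝ) := by
  simp only [W, Wq]; push_cast; ring

/-- the squared distance of two rows of length `d`, coordinatewise via `List.getD`. -/
theorem sum_sq_getD : ∀ (d : ℕ) (u v : List ℕ), u.length = d → v.length = d →
    ∑ k : Fin d, (((u.getD (k : ℕ) 0 : ℕ) : ℝ) - ((v.getD (k : ℕ) 0 : ℕ) : ℝ)) ^ 2 = (sqDistN u v : ℝ)
  | 0, [], [], _, _ => by simp [sqDistN]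
  | d + 1, a :: u, b :: v, hu, hv => by
    rw [Fin.sum_univ_succ]
    simp only [Fin.val_zero, List.getD_cons_zero, Fin.val_succ, List.getD_cons_succ, sqDistN,
      Nat.cast_add, cast_sqDiffN]
    rw [sum_sq_getD d u v (by simpa using hu) (by simpa using hv)]
  | 0, _ :: _, _, hu, _ => by simp at hu
  | 0, [], _ :: _, _, hv => by simp at hv
  | _ + 1, [], _, hu, _ => by simp at hu
  | _ + 1, _ :: _, [], _, hv => by simp at hv

/-- squared distance of two certificate points `= s · sqDistN` (exact). -/
theorem dist_sq_config {d : ℕ} {s : ℚ} (hs : 0 ≤ s) {L : List (List ℕ)}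
    (hL : ∀ r ∈ L, r.length = d) (i j : Fin L.length) :
    dist (config d s L i) (config d s L j) ^ 2 = (s : ℝ) * (sqDistN (L.get i) (L.get j) : ℝ) := by
  rw [EuclideanSpace.dist_eq, Real.sq_sqrt (Finset.sum_nonneg fun _ _ => sq_nonneg _)]
  have hi := hL _ (List.get_mem L i)
  have hj := hL _ (List.get_mem L j)
  rw [← sum_sq_getD d _ _ hi hj, Finset.mul_sum]
  refine Finset.sum_congr rfl fun k _ => ?_
  simp only [config, PiLp.toLp_apply, dist_eq_norm, Real.norm_eq_abs, sq_abs]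
  rw [← mul_sub, mul_pow, Real.sq_sqrt (by exact_mod_cast hs)]

/-- the pair potential of two certificate points is the rational `Wq (s · sqDistN)`. -/
theorem lennardJones_dist_config {d : ℕ} {s : ℚ} (hs : 0 ≤ s) {L : List (List ℕ)}
    (hL : ∀ r ∈ L, r.length = d) (i j : Fin L.length) :
    lennardJones (dist (config d s L i) (config d s L j)) =
      (Wq (s * sqDistN (L.get i) (L.get j)) : ℝ) := by
  rw [lennardJones_eq_W, dist_sq_config hs hL, ← W_cast]
  push_cast; rfl

/-- a `Fin L.length`-indexed sum over `L.get` is the list sum. -/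
theorem sum_fin_get {α β : Type*} [AddCommMonoid β] (L : List α) (g : α → β) :
    ∑ i : Fin L.length, g (L.get i) = (L.map g).sum := by
  rw [← List.sum_ofFn, ← List.ofFn_getElem_eq_map]
  rfl

/-- `2 E(config) = dsum L s`. -/
theorem two_mul_interactionEnergy_config {d : ℕ} {s : ℚ} (hs : 0 ≤ s) {L : List (List ℕ)}
    (hL : ∀ r ∈ L, r.length = d) :
    2 * interactionEnergy lennardJones (config d s L) = (dsum L s : ℝ) := by
  rw [two_mul_interactionEnergy_eq_sum_sum lennardJones lennardJones_zero]
  simp_rw [lennardJones_dist_config hs hL]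
  have h : ∀ i : Fin L.length, ∑ k : Fin L.length, ((Wq (s * sqDistN (L.get i) (L.get k)) : ℚ) : ℝ)
      = (((L.map fun v => Wq (s * sqDistN (L.get i) v)).sum : ℚ) : ℝ) := fun i => by
    rw [← sum_fin_get L (fun v => Wq (s * sqDistN (L.get i) v))]
    push_cast
    rfl
  simp_rw [h]
  rw [dsum, ← sum_fin_get L (fun u => (L.map fun v => Wq (s * sqDistN u v)).sum)]
  push_cast
  rfl

/-! #### correctness of the histogram evaluation: `hsum = dsum` -/

/-- one histogram increment adds exactly one term `Wq (s·m)` to the weighted sum. -/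
theorem sum_map_incr (s : ℚ) (acc : List (ℕ × ℕ)) (m : ℕ) :
    ((incr acc m).map fun p => (p.2 : ℚ) * Wq (s * p.1)).sum =
      (acc.map fun p => (p.2 : ℚ) * Wq (s * p.1)).sum + Wq (s * m) := by
  induction acc with
  | nil => simp [incr]
  | cons p t ih =>
    obtain ⟨m', c⟩ := p
    by_cases h : m' = m
    · subst h
      simp only [incr, if_true, List.map_cons, List.sum_cons]
      push_cast; ring
    · simp only [incr, if_neg h, List.map_cons, List.sum_cons, ih]
      ring

/-- folding the increments of a row reproduces the direct sum over that row. -/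
theorem sum_map_foldl_incr (s : ℚ) (u : List ℕ) :
    ∀ (L : List (List ℕ)) (acc : List (ℕ × ℕ)),
    ((L.foldl (fun acc' v => incr acc' (sqDistN u v)) acc).map fun p => (p.2 : ℚ) * Wq (s * p.1)).sum =
      (acc.map fun p => (p.2 : ℚ) * Wq (s * p.1)).sum + (L.map fun v => Wq (s * sqDistN u v)).sum
  | [], acc => by simp
  | v :: t, acc => by
    rw [List.foldl_cons, sum_map_foldl_incr s u t, sum_map_incr]
    simp only [List.map_cons, List.sum_cons]
    ring

/-- the one-pass histogram evaluation `hsum` equals the direct double sum `dsum`. -/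
theorem hsum_eq_dsum (L : List (List ℕ)) (s : ℚ) : hsum L s = dsum L s := by
  rw [hsum, dsum]
  congr 1
  refine List.map_congr_left fun u _ => ?_
  rw [rowHist, sum_map_foldl_incr]
  simp

/-- injectivity from `Nodup` rows of the right length and `s ≠ 0`. -/
theorem config_injective {d : ℕ} {s : ℚ} (hs : 0 < s) {L : List (List ℕ)}
    (hL : ∀ r ∈ L, r.length = d) (hN : L.Nodup) : Function.Injective (config d s L) := by
  intro i j hij
  have hrow : L.get i = L.get j := by
    apply List.ext_getElem ((hL _ (List.get_mem L i)).trans (hL _ (List.get_mem L j)).symm)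
    intro k hki hkj
    have hk : k < d := (hL _ (List.get_mem L i)) ▸ hki
    have h := congrArg (fun v : EuclideanSpace ℝ (Fin d) => v ⟨k, hk⟩) hij
    simp only [config, PiLp.toLp_apply] at h
    have hs' : Real.sqrt s ≠ 0 := (Real.sqrt_pos.2 (by exact_mod_cast hs)).ne'
    have h' := mul_left_cancel₀ hs' h
    have h'' : (L.get i).getD k 0 = (L.get j).getD k 0 := by exact_mod_cast h'
    rw [List.getD_eq_getElem _ _ hki, List.getD_eq_getElem _ _ hkj] at h''
    exact h''
  exact (List.nodup_iff_injective_get.1 hN) hrow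

/-- MASTER LEMMA: a kernel-checked rational certificate `hsum L s ≤ 2b` bounds `E(N) ≤ b`. -/
theorem groundStateEnergy_le_of_cert {d : ℕ} {s : ℚ} (hs : 0 < s) {L : List (List ℕ)}
    (hL : ∀ r ∈ L, r.length = d) (hN : L.Nodup) {b : ℚ} (hb : hsum L s ≤ 2 * b) :
    groundStateEnergy lennardJones d L.length ≤ b := by
  have h1 := groundStateEnergy_lennardJones_le (config_injective hs hL hN)
  have h2 := two_mul_interactionEnergy_config hs.le hL
  rw [hsum_eq_dsum] at hb
  have hb' : ((dsum L s : ℚ) : ℝ) ≤ 2 * b := by exact_mod_cast hb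
  linarith

/-! #### site energies and separation read off the rows -/

/-- the site energy of row `i`, in closed rational form. -/
theorem siteEnergy_config {d : ℕ} {s : ℚ} (hs : 0 ≤ s) {L : List (List ℕ)}
    (hL : ∀ r ∈ L, r.length = d) (i : Fin L.length) :
    siteEnergy lennardJones (config d s L) i =
      (((L.map fun v => Wq (s * sqDistN (L.get i) v)).sum : ℚ) : ℝ) := by
  have h0 : lennardJones (dist (config d s L i) (config d s L i)) = 0 := by
    rw [dist_self, lennardJones_zero]
  unfold siteEnergy
  rw [← add_zero (Finset.sum _ _), ← h0, Finset.sum_erase_add _ _ (Finset.mem_univ i)]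
  simp_rw [lennardJones_dist_config hs hL]
  rw [← sum_fin_get L (fun v => Wq (s * sqDistN (L.get i) v))]
  push_cast
  rfl

/-- row-level separation certificate: distinct rows are at squared distance `≥ δ2 / s`. -/
def SepRows (L : List (List ℕ)) (s δ2 : ℚ) : Prop :=
  ∀ u ∈ L, ∀ v ∈ L, u = v ∨ δ2 ≤ s * sqDistN u v

/-- `SepRows` is a decidable (finite, rational) predicate. -/
instance (L : List (List ℕ)) (s δ2 : ℚ) : Decidable (SepRows L s δ2) := by
  unfold SepRows; infer_instance

/-- a certificate whose rows satisfy `SepRows L s δ²` yields a `δ`-separated configuration. -/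
theorem sep_config {d : ℕ} {s : ℚ} (hs : 0 ≤ s) {L : List (List ℕ)}
    (hL : ∀ r ∈ L, r.length = d) (hN : L.Nodup) {δ : ℝ} {δ2 : ℚ}
    (hδ2 : δ ^ 2 = (δ2 : ℝ)) (hsep : SepRows L s δ2) (j k : Fin L.length) (hjk : j ≠ k) :
    δ ≤ dist (config d s L j) (config d s L k) := by
  have hne : L.get j ≠ L.get k := fun h => hjk ((List.nodup_iff_injective_get.1 hN) h)
  have h2 : (δ2 : ℝ) ≤ (s : ℝ) * (sqDistN (L.get j) (L.get k) : ℝ) := by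
    rcases hsep _ (List.get_mem L j) _ (List.get_mem L k) with h | h
    · exact absurd h hne
    · exact_mod_cast h
  rw [← dist_sq_config hs hL] at h2
  rw [← hδ2] at h2
  by_contra hlt
  rw [not_le] at hlt
  nlinarith [dist_nonneg (x := config d s L j) (y := config d s L k)]

end Cert

end Summit.AtomisticToContinuum.Crystallization.Theorems.StabilityConstantTwelveNegative

end
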